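import Mathlib
import HarnessLib
import Summits.Ventures.LatticeQCDFlow.Exactness.PTBCTranslationErgodic
import Summits.Ventures.LatticeQCDFlow.Exactness.CabibboMarinariLatticeErgodic

/-!
# PTBC with `SU(N)` Cabibbo–Marinari in-replica sweeps is uniformly ergodic

HONEST FRAMING: exact (Metropolis-corrected) sampling algorithms for lattice gauge theory;
figures of merit are autocorrelation/cost numbers at stated couplings and volumes; no
continuum-physics claim.

Venture `LatticeQCDFlow` (cell pub-lqcd), topic `Exactness`, FANOUT row 9 (eng-latcore, the
engine `latflow.core.ptbc` for `SU(N)` — rows 22–24 `su3-ptbc`/`su3-dsnf`: each replica is swept by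
the Cabibbo–Marinari pseudo-heat-bath (`updates.sweep`), then neighbouring replicas are swapped
and the periodic replica translated).  NEW WORK of the cell over the tree
(`CabibboMarinariLatticeErgodic.lean` (gen-10): `latSweep`, `latSweep_minorised` (Doeblin by a
multiple of `⊗Haar` from every configuration), `latSweep_invariant_piGibbsLaw`,
`isMarkovKernel_latSweep`; `PTBCTranslationErgodic.lean`: `ptbc_uniformlyErgodic_of_inReplica`).
Nothing here is cited as a fact.

* `exists_common_minorant` — finitely many Doeblin constants have a common positive one (their
  product: each is `≤ 1`);
* **`ptbc_cabibboMarinari_uniformlyErgodic`** — `R` replicas of `SU(n)^ι`, bounded measurable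
  replica actions `a ≤ S q ≤ b`, in-replica update = the CM sweep `latSweep (e^{−S q}) frames links`
  (frames in lexicographic order or its reverse, `links` through every link), then the lifted swaps
  along any list of replica pairs and the lifted translation of replica `r₀` by a `⊗Haar`- and
  `S r₀`-preserving measurable bijection: there is `ε ∈ (0, 1]`… stated as: for some `ε₀ > 0`, for every
  initial law `|μ₀ Cᵗ(A) − (⊗_q Z_q⁻¹e^{−S_q}·⊗Haar)(A)| ≤ (1 − ε₀^{|L|})ᵗ`, and the product of the
  tempered Gibbs laws is the ONLY invariant probability law of the cycle.

NOT CLAIMED: the identification of `S q` with the defect-weighted Wilson action at `c(q)` and of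
the engine's shift with such a `T`; over-relaxation inside the replicas (exact; compose as in
`heatBathSweep_comp_*`); swap statistics; rates.
-/

noncomputable section

namespace Summit.Ventures.LatticeQCDFlow.Exactness

open MeasureTheory ProbabilityTheory Set Function
open scoped ENNReal

section Common

variable {R : Type*} [Fintype R] {Ω : Type*} [MeasurableSpace Ω]

/-- **Finitely many Doeblin constants have a common positive one**: if `K r` is Markov and
`ε r • ν ≤ K r x` for all `x` (`ν` a probability law, `ε r ≠ 0`), then `(∏ q, ε q) • ν ≤ K r x` for
every `r`, `x`, and `∏ q, ε q ≠ 0`. -/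
theorem exists_common_minorant {K : R → Kernel Ω Ω} [∀ r, IsMarkovKernel (K r)] {ν : Measure Ω}
    [IsProbabilityMeasure ν] {ε : R → ℝ≥0∞} (hε : ∀ r, ε r ≠ 0) (h : ∀ r x, ε r • ν ≤ K r x) :
    (∏ q, ε q) ≠ 0 ∧ ∀ r x, (∏ q, ε q) • ν ≤ K r x := by
  classical
  have hle1 : ∀ q, ε q ≤ 1 := fun q => by
    obtain ⟨x⟩ := nonempty_of_isProbabilityMeasure ν
    have hq := Measure.le_iff'.1 (h q x) univ
    rwa [Measure.smul_apply, smul_eq_mul, measure_univ, measure_univ, mul_one] at hq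
  refine ⟨Finset.prod_ne_zero_iff.2 fun q _ => hε q, fun r x => le_trans ?_ (h r x)⟩
  have hprod : ∏ q, ε q ≤ ε r :=
    calc ∏ q, ε q = ε r * ∏ q ∈ Finset.univ.erase r, ε q := (Finset.mul_prod_erase _ _ (Finset.mem_univ r)).symm
      _ ≤ ε r * 1 := mul_le_mul' le_rfl (Finset.prod_le_one' fun q _ => hle1 q)
      _ = ε r := mul_one _
  refine Measure.le_iff.2 fun s _ => ?_
  rw [Measure.smul_apply, Measure.smul_apply, smul_eq_mul, smul_eq_mul]
  exact mul_le_mul' hprod le_rfl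

end Common

section CM

variable {R : Type*} [DecidableEq R] [Fintype R] {n : Type*} [Fintype n] [DecidableEq n] [Nonempty n]
  [LinearOrder n] {ι : Type*} [Fintype ι] [DecidableEq ι] {m : Type*} [Fintype m] [DecidableEq m]
  {S : R → Cfg ι n → ℝ}

/-- **PTBC WITH CABIBBO–MARINARI IN-REPLICA SWEEPS IS UNIFORMLY ERGODIC** (`SU(n)`, any finite link
set, bounded measurable replica actions): with the CM sweep of replica `q` for the weight `e^{−S q}`
(frames `n ≃ Fin 2 ⊕ m` in lexicographic order or its reverse, `links` through every link), the swaps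
along `P` and the translation of `r₀` by `T`, the cycle `C = (translation ∘ₖ swaps) ∘ₖ replicaSweep`
satisfies, for some `ε₀ > 0`: `|μ₀ Cᵗ(A) − ptbcTarget(A)| ≤ (1 − ε₀^{|L|})ᵗ` for every initial law, and
`ptbcTarget` — the product of the tempered laws `Z_q⁻¹e^{−S_q}·⊗Haar` — is its ONLY invariant
probability law. -/
theorem ptbc_cabibboMarinari_uniformlyErgodic (hS : ∀ q, Measurable (S q)) {a b : ℝ}
    (hab : ∀ q ω, a ≤ S q ω ∧ S q ω ≤ b) (frames : List (n ≃ Fin 2 ⊕ m))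
    (hlex : frames.map pairOf = lexPairs (Finset.univ.sort (· ≤ ·) : List n) ∨
      frames.map pairOf = (lexPairs (Finset.univ.sort (· ≤ ·) : List n)).reverse)
    {links : List ι} (hl : ∀ l, l ∈ links) {L : List R} (hL : ∀ r, r ∈ L) (P : List (R × R))
    (T : Cfg ι n ≃ᵐ Cfg ι n) (hT : MeasurePreserving T (Measure.pi (linkHaar ι n)) (Measure.pi (linkHaar ι n)))
    (r₀ : R) (hST : ∀ ω, S r₀ (T ω) = S r₀ ω) :
    ∃ ε₀ : ℝ≥0∞, 0 < ε₀ ∧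
      (∀ (μ₀ : Measure (R → Cfg ι n)) [IsProbabilityMeasure μ₀] (t : ℕ) (A : Set (R → Cfg ι n)),
        |((fun ν : Measure (R → Cfg ι n) =>
              ν.bind ((ptbcTranslation T T.measurable r₀ ∘ₖ ptbcSwaps S P) ∘ₖ
                replicaSweep (fun q => latSweep (ptbcDensity S q) frames links) L))^[t] μ₀).real A
            - (ptbcTarget (linkHaar ι n) (ptbcDensity S)).real A| ≤ (1 - (ε₀ ^ L.length).toReal) ^ t) ∧
      ∀ (Q : Measure (R → Cfg ι n)) [IsProbabilityMeasure Q],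
        Kernel.Invariant ((ptbcTranslation T T.measurable r₀ ∘ₖ ptbcSwaps S P) ∘ₖ
          replicaSweep (fun q => latSweep (ptbcDensity S q) frames links) L) Q →
          Q = ptbcTarget (linkHaar ι n) (ptbcDensity S) := by
  have hm0 : ENNReal.ofReal (Real.exp (-b)) ≠ 0 := by
    rw [Ne, ENNReal.ofReal_eq_zero, not_le]; exact Real.exp_pos (-b)
  have hlo : ∀ q ω, ENNReal.ofReal (Real.exp (-b)) ≤ ptbcDensity S q ω := fun q ω => (ptbcDensity_pinched hab q ω).1
  have hhi : ∀ q ω, ptbcDensity S q ω ≤ ENNReal.ofReal (Real.exp (-a)) := fun q ω => (ptbcDensity_pinched hab q ω).2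
  haveI : ∀ q, IsMarkovKernel (latSweep (ptbcDensity S q) frames links) := fun q =>
    isMarkovKernel_latSweep (measurable_ptbcDensity hS q) hm0 ENNReal.ofReal_ne_top (hlo q) (hhi q) frames links
  choose ε hε hmin using fun q => latSweep_minorised (measurable_ptbcDensity hS q) hm0 ENNReal.ofReal_ne_top
    (hlo q) (hhi q) frames hlex hl
  obtain ⟨hε0, hcommon⟩ := exists_common_minorant (K := fun q => latSweep (ptbcDensity S q) frames links)
    (ν := Measure.pi (linkHaar ι n)) hε hmin
  refine ⟨∏ q, ε q, pos_iff_ne_zero.2 hε0, ?_⟩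
  exact ptbc_uniformlyErgodic_of_inReplica (μ := linkHaar ι n) hS hab hcommon (pos_iff_ne_zero.2 hε0)
    (fun q => latSweep_invariant_piGibbsLaw (measurable_ptbcDensity hS q) hm0 ENNReal.ofReal_ne_top (hlo q) (hhi q)
      frames links) hL P T hT r₀ hST

end CM

end Summit.Ventures.LatticeQCDFlow.Exactness
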